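import Literature.Analysis.Fourier.TorusCoefficientBound
import Mathlib.Analysis.Normed.Ring.InfiniteSum
import Mathlib.Tactic
import HarnessLib

/-!
# Products of absolutely convergent one-variable series are absolutely convergent multiple series

The analytic input needed to apply the torus Cauchy estimate `TorusCoeff.norm_coeff_le_of_bound`
to functions of the form `G(𝐳) = Σ_j c_j Π_s g_{j,s}(z_s)` (finite sums of products of
one-variable functions, the shape of the damped pullback `W(𝐳)·h(z_1)⋯h(z_d)·F(Φ(𝐳))` of
Calegari–Dimitrov–Tang, arXiv:2408.15403, §6.4–6.5, eq. (6.15), (6.18), (6.21)): if each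
one-variable factor has absolutely summable coefficients `b_s`, then
`Π_s (Σ_n b_s(n) w_s(n)) = Σ_𝛎 Π_s b_s(ν_s) w_s(ν_s)` with `Σ_𝛎 Π_s |b_s(ν_s)| < ∞`
(`summable_norm_piProd`, `tsum_piProd`), and on the torus
`Π_s (Σ_n b_s(n) e(n θ_s)) = fseries (Π_s b_s(ν_s)) 𝛉` (`prod_fseries₁_eq_fseries`).

No named facts.

## References

* [CalegariDimitrovTang2024] arXiv:2408.15403, §6.4 eq. (6.15), §6.5.3 eq. (6.21).
-/

noncomputable section

open Finset

namespace Literature.Analysis.Fourier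

namespace TorusCoeff

/-- **Finite products of absolutely summable series** (over `ℕ`, indexed by `Fin d`): the family
`𝛎 ↦ Π_s f_s(ν_s)` is absolutely summable and its sum is the product of the sums. [folklore] -/
theorem summable_norm_piProd_and_tsum : ∀ (d : ℕ) (f : Fin d → ℕ → ℂ),
    (∀ s, Summable fun n => ‖f s n‖) →
      (Summable fun ν : Fin d → ℕ => ‖∏ s, f s (ν s)‖) ∧
        ∑' ν : Fin d → ℕ, ∏ s, f s (ν s) = ∏ s, ∑' n, f s n := by
  intro d
  induction d with
  | zero =>
    intro f _
    refine ⟨?_, ?_⟩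
    · exact (hasSum_fintype _).summable
    · simp [tsum_fintype]
  | succ d ih =>
    intro f hf
    obtain ⟨ih1, ih2⟩ := ih (fun s => f s.succ) (fun s => hf s.succ)
    have h0 := hf 0
    -- split `Fin (d+1) → ℕ ≃ ℕ × (Fin d → ℕ)`
    let e : (ℕ × (Fin d → ℕ)) ≃ (Fin (d + 1) → ℕ) := Fin.consEquiv (fun _ => ℕ)
    have hfun : ∀ p : ℕ × (Fin d → ℕ), ∏ s, f s (e p s) = f 0 p.1 * ∏ s : Fin d, f s.succ (p.2 s) := by
      intro p
      rw [Fin.prod_univ_succ]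
      rfl
    have hnorm : Summable fun p : ℕ × (Fin d → ℕ) => ‖f 0 p.1 * ∏ s : Fin d, f s.succ (p.2 s)‖ :=
      Summable.mul_norm (f := f 0) (g := fun ν : Fin d → ℕ => ∏ s : Fin d, f s.succ (ν s)) h0 ih1
    refine ⟨?_, ?_⟩
    · have : Summable fun p : ℕ × (Fin d → ℕ) => ‖∏ s, f s (e p s)‖ := hnorm.congr fun p => by rw [hfun]
      exact (e.summable_iff (f := fun ν : Fin (d + 1) → ℕ => ‖∏ s, f s (ν s)‖)).mp this
    · rw [Fin.prod_univ_succ, ← ih2, tsum_mul_tsum_of_summable_norm (f := f 0)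
        (g := fun ν : Fin d → ℕ => ∏ s : Fin d, f s.succ (ν s)) h0 ih1]
      rw [← e.tsum_eq (fun ν : Fin (d + 1) → ℕ => ∏ s, f s (ν s))]
      exact tsum_congr fun p => hfun p

/-- Absolute summability of `𝛎 ↦ Π_s f_s(ν_s)`. [folklore] -/
theorem summable_norm_piProd {d : ℕ} (f : Fin d → ℕ → ℂ) (hf : ∀ s, Summable fun n => ‖f s n‖) :
    Summable fun ν : Fin d → ℕ => ‖∏ s, f s (ν s)‖ :=
  (summable_norm_piProd_and_tsum d f hf).1

/-- `Σ_𝛎 Π_s f_s(ν_s) = Π_s Σ_n f_s(n)`. [folklore] -/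
theorem tsum_piProd {d : ℕ} (f : Fin d → ℕ → ℂ) (hf : ∀ s, Summable fun n => ‖f s n‖) :
    ∑' ν : Fin d → ℕ, ∏ s, f s (ν s) = ∏ s, ∑' n, f s n :=
  (summable_norm_piProd_and_tsum d f hf).2

/-- The one-variable Fourier/power series on the circle `Σ_n b(n) e(nθ)`. [folklore] -/
def fseries₁ (b : ℕ → ℂ) (θ : ℝ) : ℂ := ∑' n, b n * Complex.exp (2 * Real.pi * Complex.I * (n : ℤ) * θ)

/-- **Products of one-variable series on the torus are multiple series**:
`Π_s fseries₁ b_s θ_s = fseries (𝛎 ↦ Π_s b_s(ν_s)) 𝛉`, with absolutely summable coefficients.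
[cite: CalegariDimitrovTang2024, §6.4 eq. (6.15) (the product structure of `G`)] -/
theorem prod_fseries₁_eq_fseries {d : ℕ} (b : Fin d → ℕ → ℂ) (hb : ∀ s, Summable fun n => ‖b s n‖)
    (θ : Fin d → ℝ) :
    ∏ s, fseries₁ (b s) (θ s) = fseries (fun ν => ∏ s, b s (ν s)) θ := by
  unfold fseries₁ fseries echar
  set f : Fin d → ℕ → ℂ := fun s n => b s n * Complex.exp (2 * Real.pi * Complex.I * (n : ℤ) * θ s) with hf
  have hfn : ∀ s, Summable fun n => ‖f s n‖ := by
    intro s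
    refine (hb s).congr fun n => ?_
    rw [hf]; simp only
    rw [norm_mul, show (2 * Real.pi * Complex.I * ((n : ℤ) : ℂ) * θ s : ℂ) =
      ((2 * Real.pi * n * θ s : ℝ) : ℂ) * Complex.I by push_cast; ring, Complex.norm_exp_ofReal_mul_I, mul_one]
  rw [← tsum_piProd f hfn]
  refine tsum_congr fun ν => ?_
  rw [hf, Finset.prod_mul_distrib]

/-- The coefficients `Π_s b_s(ν_s)` are absolutely summable. [folklore] -/
theorem summable_norm_prod_coeff {d : ℕ} (b : Fin d → ℕ → ℂ) (hb : ∀ s, Summable fun n => ‖b s n‖) :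
    Summable fun ν : Fin d → ℕ => ‖∏ s, b s (ν s)‖ :=
  summable_norm_piProd b hb

end TorusCoeff

end Literature.Analysis.Fourier
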